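import Summits.QuantumFields.YangMills.Theorems.SwapVirialDeficitBlowUpGnomonicFibreRescaledSockets
import Summits.QuantumFields.YangMills.Theorems.SwapVirialDeficitSectorLaplaceMbDensityAnisoCeiling
import Summits.QuantumFields.YangMills.Theorems.SwapVirialDeficitBlowUpGnomonicRayDerivMeasurable
import Summits.QuantumFields.YangMills.Theorems.SwapVirialDeficitSectorLaplaceBulkIntegrated
import HarnessLib

/-!
# STUB S3-ON-BULK OF THE (S)∕➎ SKELETON: the Morse–Bott density `𝔪(a,ε,p)` is jointly measurable and INTEGRABLE over (bulk hubs) × (the whole base plane)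
# (free-hands support of ⟨stmt-QuantumFields-24197⟩ `SwapVirialDeficit.SwapGluedStiffness` ∕ ⟨24194⟩; cell ym-idea-1, LEAD g98 ruling ➎ «S3 measurability + integrability
# on BULK base sets only», assembler fcl-p3 g47's (Ra) Fubini)

g47's region (Ra) law integrates w2's ✓`SectorLaplace.bulk_fibred_plane` over the bulk hubs `HubBulk τ` against the probability `coneMeasure`; the Fubini step needs exactly
`IntegrableOn (fun ap => mbDensity ap.1 ε ap.2) (HubBulk τ ×ˢ univ) (coneMeasure.prod volume)` for every good sign pattern `ε` and cut `τ ∈ (0,1]` (g47 18:56Z).  Here: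
* §1 `aniso_diag_arith` + ★ `fibQ_ge_diag_of_hub` — the DIAGONAL part of w3 g66's ✓`fibre_raySecond_ge_aniso` in the unscaled fibre letters: for `τ ≤ sin²2ψ`, `τ ≤ sin²ψ`,
  `Q_{a,ε,p}(y) ≥ τ|u|²∕(6075L⁶(1+x₀²)) + τ|v|²∕(6075L⁶(1+y₀²)) + |z|²∕(6075L⁶) + Σ_f|η_f|²∕(1728L⁶|Fol L|)`;
* §2 ★★ `exists_mbDensity_le_weight_of_hubBulk` — the INTEGRABLE MAJORANT on bulk hubs: `𝔪(a,ε,p) ≤ C(L,τ)·(1+x₀²)⁻¹(1+y₀²)⁻¹` for all `a ∈ HubBulk τ`, `p ∈ ℝ²`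
  (✓`mbDensity_le_of_aniso_floor`: the soft modes cost `κ_x⁻¹κ_y⁻¹ ∝ (1+x₀²)(1+y₀²)∕τ²`, and `ρ(gnoBase p)(1+x₀²)(1+y₀²) = (1+x₀²)⁻¹(1+y₀²)⁻¹`);
* §3 ★ `measurable_mbDensity_hubFix` — `(a,p) ↦ 𝔪(a′,ε,p)` is jointly measurable, `a′ := a` off the null hub `a = 0` (w3 ✓`measurable_raySecond_gnoDeficit_param` ∘
  `StronglyMeasurable.integral_prod_right'`), hence `aestronglyMeasurable` on every bulk set; ★★★ `integrableOn_mbDensity_hubBulk` — THE EXPORT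
  `IntegrableOn (fun ap => mbDensity ap.1 ε ap.2) (HubBulk τ ×ˢ univ) (coneMeasure.prod volume)` (`GoodSign ε`, `0 < τ ≤ 1`), and its Fubini corollary
  `integrableOn_integral_mbDensity_hubBulk` (`a ↦ ∫_{ℝ²} 𝔪(a,ε,p) dp` integrable on `HubBulk τ`).

HONEST LABEL: the bulk part of S3 only (nothing at the apex ∕ the crossing Σ, which ➎ does not need); regions' laws, ⟨24197⟩ ∕ ⟨24194⟩ OPEN; own crux ⟨22884⟩
`LargeFieldMassRefinementTail` OPEN (blocked-on ⟨19935⟩); the Yang–Mills mass gap is NOT proved; no summit is proved by a line.  THEOREMS ONLY (0 `def`, 0 `sorry`,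
no instance; the series' local `ℍ` instances), standard axioms.  Width seat ym-line-sfw-p2-w2 g59 (cell ym-idea-1, free hands), `--supports stmt-QuantumFields-24197`.
References: [cite: Luscher1983, §2]; [cite: Breitung1994, Lemma 26 (2.102) p. 30]; [folklore].
-/

set_option autoImplicit false
set_option synthInstance.maxSize 1024

noncomputable section

open MeasureTheory Quaternion Set Metric Module
open scoped Quaternion BigOperators ENNReal InnerProductSpace
open Literature.MathematicalPhysics.QuantumLattice
open Literature.MathematicalPhysics.QuantumFieldTheory hiding SU2
open Summit.QuantumFields.YangMills.Theorems.SwapTwistDeficit.ToronLog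

attribute [local instance] Literature.Analysis.FluidPDE.Tao2016.quatMeasurableSpace
  Literature.Analysis.FluidPDE.Tao2016.quatBorelSpace
  Literature.MathematicalPhysics.QuantumLattice.secondCountableTopology_su2

namespace Summit.QuantumFields.YangMills.Theorems.SwapVirialDeficit.SectorLaplace

open Summit.QuantumFields.YangMills.Theorems.FemtoTransferGap
open Summit.QuantumFields.YangMills.Theorems.FemtoTransferGap.TT
open Summit.QuantumFields.YangMills.Theorems.VirialFluxGap.RingDeficit
open Summit.QuantumFields.YangMills.Theorems.SwapVirialDeficit.SwapRing
open Summit.QuantumFields.YangMills.Theorems.SwapVirialDeficit.BlowUpRing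
open Summit.QuantumFields.YangMills.Theorems.SwapVirialDeficit.Gnomonic (normSq3 normSq3_nonneg)

variable {L : ℕ} [NeZero L]

/-! ## §1 The diagonal floor of the fibre form at a bulk hub -/

omit [NeZero L] in
/-- The scalar inequality behind ✓`fibQ_ge_diag_of_hub` (opaque reals; `cx = 1 + x₀²`, `cy = 1 + y₀²`). [folklore] -/
theorem aniso_diag_arith {τ S1 S2 U V Z F Rel ℓ card cx cy : ℝ} (hS1 : τ ≤ S1) (hS2 : τ ≤ S2)
    (hU : 0 ≤ U) (hV : 0 ≤ V) (hRel : 0 ≤ Rel) (hℓ : 0 < ℓ) (hcx : 0 < cx) (hcy : 0 < cy) :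
    τ / (6075 * ℓ ^ 6 * cx) * U + τ / (6075 * ℓ ^ 6 * cy) * V + 1 / (6075 * ℓ ^ 6) * Z + 1 / (1728 * ℓ ^ 6 * card) * F ≤
      2 / 3 * ((S1 * (4 * U / cx) + S2 * (4 * V / cy) + 4 * Z) / (16200 * ℓ ^ 6) + 2 * F / (2304 * ℓ ^ 6 * card) + Rel) := by
  have h1 : τ / (6075 * ℓ ^ 6 * cx) * U ≤ 2 / 3 * (S1 * (4 * U / cx) / (16200 * ℓ ^ 6)) := by
    rw [show 2 / 3 * (S1 * (4 * U / cx) / (16200 * ℓ ^ 6)) = S1 / (6075 * ℓ ^ 6 * cx) * U by ring]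
    exact mul_le_mul_of_nonneg_right (div_le_div_of_nonneg_right hS1 (by positivity)) hU
  have h2 : τ / (6075 * ℓ ^ 6 * cy) * V ≤ 2 / 3 * (S2 * (4 * V / cy) / (16200 * ℓ ^ 6)) := by
    rw [show 2 / 3 * (S2 * (4 * V / cy) / (16200 * ℓ ^ 6)) = S2 / (6075 * ℓ ^ 6 * cy) * V by ring]
    exact mul_le_mul_of_nonneg_right (div_le_div_of_nonneg_right hS2 (by positivity)) hV
  have h3 : 1 / (6075 * ℓ ^ 6) * Z = 2 / 3 * (4 * Z / (16200 * ℓ ^ 6)) := by ring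
  have h4 : 1 / (1728 * ℓ ^ 6 * card) * F = 2 / 3 * (2 * F / (2304 * ℓ ^ 6 * card)) := by ring
  have e : 2 / 3 * ((S1 * (4 * U / cx) + S2 * (4 * V / cy) + 4 * Z) / (16200 * ℓ ^ 6) + 2 * F / (2304 * ℓ ^ 6 * card) + Rel) =
      2 / 3 * (S1 * (4 * U / cx) / (16200 * ℓ ^ 6)) + 2 / 3 * (S2 * (4 * V / cy) / (16200 * ℓ ^ 6)) + 2 / 3 * (4 * Z / (16200 * ℓ ^ 6)) +
        2 / 3 * (2 * F / (2304 * ℓ ^ 6 * card)) + 2 / 3 * Rel := by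
    ring
  rw [e, h3, h4]
  linarith [mul_nonneg (by norm_num : (0 : ℝ) ≤ 2 / 3) hRel]

/-- ★ **THE DIAGONAL FLOOR OF THE FIBRE FORM AT A BULK HUB** (`a ≠ 0`, `τ ≤ sin²2ψ`, `τ ≤ sin²ψ`, good signs), unscaled letters `((u,v),z,η_F) = gnoFibreBlocks y`:
`τ|u|²∕(6075L⁶(1+x₀²)) + τ|v|²∕(6075L⁶(1+y₀²)) + |z|²∕(6075L⁶) + Σ_f|η_f|²∕(1728L⁶|Fol L|) ≤ Q_{a,ε,p}(y)` — the diagonal part of ✓`fibre_raySecond_ge_aniso`.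
[cite: Luscher1983, §2] -/
theorem fibQ_ge_diag_of_hub {a : ℍ} (ha : a ≠ 0) {ε : GnoSign L} (hε : GoodSign ε) {τ : ℝ} (hS1 : τ ≤ hubS1 a) (hS2 : τ ≤ hubS2 a)
    (p : ℝ × ℝ) (y : GnoFibre L) :
    τ / (6075 * (L : ℝ) ^ 6 * (1 + p.1 ^ 2)) * ((gnoFibreBlocks y).1.1 0 ^ 2 + (gnoFibreBlocks y).1.1 1 ^ 2) +
        τ / (6075 * (L : ℝ) ^ 6 * (1 + p.2 ^ 2)) * ((gnoFibreBlocks y).1.2 0 ^ 2 + (gnoFibreBlocks y).1.2 1 ^ 2) +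
        1 / (6075 * (L : ℝ) ^ 6) * normSq3 (gnoFibreBlocks y).2.1 + 1 / (1728 * (L : ℝ) ^ 6 * (Fintype.card (Fol L) : ℝ)) * ∑ f, normSq3 ((gnoFibreBlocks y).2.2 f) ≤
      fibQ a ε p y := by
  obtain ⟨hz, hF⟩ := hε
  obtain ⟨hcard0, -, hL1⟩ := card_fol_facts (L := L)
  have hL : (0 : ℝ) < (L : ℝ) := by linarith
  -- `positivity` facts first (before the big hypothesis `key`)
  have hx0 : (0 : ℝ) < 1 + p.1 ^ 2 := by positivity
  have hy0 : (0 : ℝ) < 1 + p.2 ^ 2 := by positivity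
  have hU0 : 0 ≤ (gnoFibreBlocks y).1.1 0 ^ 2 + (gnoFibreBlocks y).1.1 1 ^ 2 := by positivity
  have hV0 : 0 ≤ (gnoFibreBlocks y).1.2 0 ^ 2 + (gnoFibreBlocks y).1.2 1 ^ 2 := by positivity
  have hZ0 : 0 ≤ normSq3 (gnoFibreBlocks y).2.1 := normSq3_nonneg _
  have hrel : 0 ≤ ((p.2 * (gnoFibreBlocks y).1.1 0 - p.1 * (gnoFibreBlocks y).1.2 0) ^ 2 + (p.2 * (gnoFibreBlocks y).1.1 1 - p.1 * (gnoFibreBlocks y).1.2 1) ^ 2) /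
      (450 * (L : ℝ) ^ 6 * ((1 + p.1 ^ 2) * (1 + p.2 ^ 2))) := by positivity
  have hF0 : 0 ≤ ∑ f, normSq3 ((gnoFibreBlocks y).2.2 f) := Finset.sum_nonneg fun f _ => normSq3_nonneg _
  have eF : ∑ f, 2 * normSq3 ((gnoFibreBlocks y).2.2 f) = 2 * ∑ f, normSq3 ((gnoFibreBlocks y).2.2 f) := by rw [Finset.mul_sum]
  -- w3's anisotropic floor, read on the Euclidean fibre
  have key := fibre_raySecond_ge_aniso ha ε hz hF p.1 p.2 (gnoFibreBlocks y)
  have hQ : iteratedDeriv 2 (fun s : ℝ => gnoDeficit (fun _ => false) (fun _ => 1) a ε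
        (((((![p.1, 0, 0] : Fin 3 → ℝ), (![p.2, 0, 0] : Fin 3 → ℝ)), ((0 : Fin 3 → ℝ), (0 : Fol L → Fin 3 → ℝ))) : GnoCoord L) +
          s • ((((![0, (gnoFibreBlocks y).1.1 0, (gnoFibreBlocks y).1.1 1] : Fin 3 → ℝ), (![0, (gnoFibreBlocks y).1.2 0, (gnoFibreBlocks y).1.2 1] : Fin 3 → ℝ)),
            ((gnoFibreBlocks y).2.1, (gnoFibreBlocks y).2.2)) : GnoCoord L))) 0 = fibQ a ε p y := by
    unfold fibQ
    rw [gnoFibreEmb_eq_fibreDir]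
    rfl
  rw [hQ, eF] at key
  unfold hubS1 at hS1
  unfold hubS2 at hS2
  exact (aniso_diag_arith hS1 hS2 hU0 hV0 hrel hL hx0 hy0).trans key

/-! ## §2 The integrable majorant of the density on bulk hubs -/

/-- `(κ^{−1∕2})² = κ⁻¹` for `0 < κ`. [folklore] -/
theorem rpow_neg_half_sq {κ : ℝ} (hκ : 0 < κ) : (κ ^ (-(1 / 2 : ℝ))) ^ 2 = κ⁻¹ := by
  rw [← Real.rpow_natCast, ← Real.rpow_mul hκ.le]
  norm_num
  rw [Real.rpow_neg_one]

/-- ★★ **THE INTEGRABLE MAJORANT OF THE MORSE–BOTT DENSITY ON BULK HUBS**: for good signs and a cut `0 < τ ≤ 1` there is `C = C(L,τ) ≥ 0` with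
`𝔪(a,ε,p) ≤ C·(1+x₀²)⁻¹(1+y₀²)⁻¹` for every `a ∈ HubBulk τ` and `p ∈ ℝ²` (✓`mbDensity_le_of_aniso_floor` on the diagonal floor ✓`fibQ_ge_diag_of_hub`; the soft modes cost
`κ_x⁻¹κ_y⁻¹ = (6075L⁶)²(1+x₀²)(1+y₀²)∕τ²` against `ρ(gnoBase p) = (1+x₀²)⁻²(1+y₀²)⁻²`). [cite: Breitung1994, Lemma 26 (2.102), p. 30] -/
theorem exists_mbDensity_le_weight_of_hubBulk {ε : GnoSign L} (hε : GoodSign ε) {τ : ℝ} (hτ : 0 < τ) (hτ1 : τ ≤ 1) :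
    ∃ C : ℝ, 0 ≤ C ∧ ∀ a ∈ HubBulk τ, ∀ p : ℝ × ℝ, mbDensity (L := L) a ε p ≤ C * ((1 + p.1 ^ 2)⁻¹ * (1 + p.2 ^ 2)⁻¹) := by
  obtain ⟨hcard0, -, hL1⟩ := card_fol_facts (L := L)
  have hL : (0 : ℝ) < (L : ℝ) := by linarith
  set κz : ℝ := 1 / (6075 * (L : ℝ) ^ 6) with hκz
  set κF : ℝ := 1 / (1728 * (L : ℝ) ^ 6 * (Fintype.card (Fol L) : ℝ)) with hκF
  have hκz0 : 0 < κz := by rw [hκz]; positivity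
  have hκF0 : 0 < κF := by rw [hκF]; positivity
  refine ⟨(6075 * (L : ℝ) ^ 6) ^ 2 / τ ^ 2 * ((κz ^ (-(1 / 2 : ℝ))) ^ 3 * (κF ^ (-(1 / 2 : ℝ))) ^ (Fintype.card (Fol L) * 3)), by positivity, ?_⟩
  intro a haB p
  obtain ⟨ha, hS1, hS2⟩ : a ≠ 0 ∧ τ ≤ hubS1 a ∧ τ ≤ hubS2 a := haB
  have hx0 : (0 : ℝ) < 1 + p.1 ^ 2 := by positivity
  have hy0 : (0 : ℝ) < 1 + p.2 ^ 2 := by positivity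
  set κx : ℝ := τ / (6075 * (L : ℝ) ^ 6 * (1 + p.1 ^ 2)) with hκx
  set κy : ℝ := τ / (6075 * (L : ℝ) ^ 6 * (1 + p.2 ^ 2)) with hκy
  have hκx0 : 0 < κx := by rw [hκx]; positivity
  have hκy0 : 0 < κy := by rw [hκy]; positivity
  -- a common floor
  set lam : ℝ := τ / (6075 * (L : ℝ) ^ 6 * (1 + p.1 ^ 2) * (1 + p.2 ^ 2) * (Fintype.card (Fol L) : ℝ)) with hlam
  have hlam0 : 0 < lam := by rw [hlam]; positivity
  have hc1 : (1 : ℝ) ≤ Fintype.card (Fol L) := by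
    have h : 0 < Fintype.card (Fol L) := by exact_mod_cast hcard0
    exact_mod_cast h
  have hcx1 : (1 : ℝ) ≤ 1 + p.1 ^ 2 := by nlinarith [sq_nonneg p.1]
  have hcy1 : (1 : ℝ) ≤ 1 + p.2 ^ 2 := by nlinarith [sq_nonneg p.2]
  have hB0 : (0 : ℝ) < 6075 * (L : ℝ) ^ 6 * (1 + p.1 ^ 2) * (1 + p.2 ^ 2) * (Fintype.card (Fol L) : ℝ) := by positivity
  have hlx : lam ≤ κx := by
    rw [hlam, hκx]
    refine div_le_div_of_nonneg_left hτ.le (by positivity) ?_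
    calc 6075 * (L : ℝ) ^ 6 * (1 + p.1 ^ 2) = 6075 * (L : ℝ) ^ 6 * (1 + p.1 ^ 2) * 1 * 1 := by ring
      _ ≤ 6075 * (L : ℝ) ^ 6 * (1 + p.1 ^ 2) * (1 + p.2 ^ 2) * (Fintype.card (Fol L) : ℝ) := by gcongr
  have hly : lam ≤ κy := by
    rw [hlam, hκy]
    refine div_le_div_of_nonneg_left hτ.le (by positivity) ?_
    calc 6075 * (L : ℝ) ^ 6 * (1 + p.2 ^ 2) = 6075 * (L : ℝ) ^ 6 * 1 * (1 + p.2 ^ 2) * 1 := by ring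
      _ ≤ 6075 * (L : ℝ) ^ 6 * (1 + p.1 ^ 2) * (1 + p.2 ^ 2) * (Fintype.card (Fol L) : ℝ) := by gcongr
  have hlz : lam ≤ κz := by
    rw [hlam, hκz]
    calc τ / (6075 * (L : ℝ) ^ 6 * (1 + p.1 ^ 2) * (1 + p.2 ^ 2) * (Fintype.card (Fol L) : ℝ))
        ≤ 1 / (6075 * (L : ℝ) ^ 6 * (1 + p.1 ^ 2) * (1 + p.2 ^ 2) * (Fintype.card (Fol L) : ℝ)) := div_le_div_of_nonneg_right hτ1 hB0.le
      _ ≤ 1 / (6075 * (L : ℝ) ^ 6) := by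
          refine div_le_div_of_nonneg_left zero_le_one (by positivity) ?_
          calc 6075 * (L : ℝ) ^ 6 = 6075 * (L : ℝ) ^ 6 * 1 * 1 * 1 := by ring
            _ ≤ 6075 * (L : ℝ) ^ 6 * (1 + p.1 ^ 2) * (1 + p.2 ^ 2) * (Fintype.card (Fol L) : ℝ) := by gcongr
  have hlF : lam ≤ κF := by
    rw [hlam, hκF]
    calc τ / (6075 * (L : ℝ) ^ 6 * (1 + p.1 ^ 2) * (1 + p.2 ^ 2) * (Fintype.card (Fol L) : ℝ))
        ≤ 1 / (6075 * (L : ℝ) ^ 6 * (1 + p.1 ^ 2) * (1 + p.2 ^ 2) * (Fintype.card (Fol L) : ℝ)) := div_le_div_of_nonneg_right hτ1 hB0.le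
      _ ≤ 1 / (1728 * (L : ℝ) ^ 6 * (Fintype.card (Fol L) : ℝ)) := by
          refine div_le_div_of_nonneg_left zero_le_one (by positivity) ?_
          calc 1728 * (L : ℝ) ^ 6 * (Fintype.card (Fol L) : ℝ) = 1728 * (L : ℝ) ^ 6 * 1 * 1 * (Fintype.card (Fol L) : ℝ) := by ring
            _ ≤ 6075 * (L : ℝ) ^ 6 * (1 + p.1 ^ 2) * (1 + p.2 ^ 2) * (Fintype.card (Fol L) : ℝ) := by gcongr; norm_num
  have hQ : ∀ y : GnoFibre L, κx * ((gnoFibreBlocks y).1.1 0 ^ 2 + (gnoFibreBlocks y).1.1 1 ^ 2) + κy * ((gnoFibreBlocks y).1.2 0 ^ 2 + (gnoFibreBlocks y).1.2 1 ^ 2) +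
      κz * normSq3 (gnoFibreBlocks y).2.1 + κF * ∑ f, normSq3 ((gnoFibreBlocks y).2.2 f) ≤ fibQ a ε p y := fun y =>
    fibQ_ge_diag_of_hub ha hε hS1 hS2 p y
  have hbd := mbDensity_le_of_aniso_floor ha ε p hlam0 hlx hly hlz hlF hQ
  rw [rpow_neg_half_sq hκx0, rpow_neg_half_sq hκy0] at hbd
  refine hbd.trans (le_of_eq ?_)
  have ej := gnoDensity_gnoBase_mul_jacobian (L := L) p
  have hxi : κx⁻¹ = 6075 * (L : ℝ) ^ 6 * (1 + p.1 ^ 2) / τ := by rw [hκx, inv_div]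
  have hyi : κy⁻¹ = 6075 * (L : ℝ) ^ 6 * (1 + p.2 ^ 2) / τ := by rw [hκy, inv_div]
  rw [hxi, hyi, ← ej]
  field_simp

/-! ## §3 Joint measurability and integrability on bulk hubs × the base plane -/

open scoped Classical in
/-- ★ **Joint measurability with the null hub repaired**: for `a′ := if a = 0 then 1 else a`, `(a,p) ↦ 𝔪(a′,ε,p)` is measurable on `ℍ × ℝ²`
(w3 ✓`measurable_raySecond_gnoDeficit_param` for the ray second derivative in all data with hub `a′ ≠ 0`, then `StronglyMeasurable.integral_prod_right'`). [folklore] -/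
theorem measurable_mbDensity_hubFix (ε : GnoSign L) :
    Measurable fun ap : ℍ × (ℝ × ℝ) => mbDensity (L := L) (if ap.1 = 0 then (1 : ℍ) else ap.1) ε ap.2 := by
  classical
  -- the repaired hub
  have h0 : MeasurableSet {a : ℍ | a = 0} := by
    rw [Set.setOf_eq_eq_singleton]; exact measurableSet_singleton 0
  have hhub1 : Measurable fun a : ℍ => if a = 0 then (1 : ℍ) else a := Measurable.ite h0 measurable_const measurable_id
  have hhub : Measurable fun x : (ℍ × (ℝ × ℝ)) × GnoFibre L => if x.1.1 = 0 then (1 : ℍ) else x.1.1 := hhub1.comp (measurable_fst.comp measurable_fst)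
  have hne : ∀ x : (ℍ × (ℝ × ℝ)) × GnoFibre L, (if x.1.1 = 0 then (1 : ℍ) else x.1.1) ≠ 0 := fun x => by
    by_cases h : x.1.1 = 0
    · rw [if_pos h]; exact one_ne_zero
    · rw [if_neg h]; exact h
  have hbase : Measurable fun x : (ℍ × (ℝ × ℝ)) × GnoFibre L => (gnoBase x.1.2.1 x.1.2.2 : GnoCoord L) :=
    (continuous_gnoBase (L := L)).measurable.comp (measurable_snd.comp measurable_fst)
  have hdir : Measurable fun x : (ℍ × (ℝ × ℝ)) × GnoFibre L => (gnoFibreEmb x.2 : GnoCoord L) :=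
    (gnoFibreEmb (L := L)).continuous.measurable.comp measurable_snd
  have hQ : Measurable fun x : (ℍ × (ℝ × ℝ)) × GnoFibre L => fibQ (if x.1.1 = 0 then (1 : ℍ) else x.1.1) ε x.1.2 x.2 :=
    measurable_raySecond_gnoDeficit_param z₀ (fun _ => 1) ε hhub hne hbase hdir
  have hG : Measurable fun x : (ℍ × (ℝ × ℝ)) × GnoFibre L => Real.exp (-(fibQ (if x.1.1 = 0 then (1 : ℍ) else x.1.1) ε x.1.2 x.2 / 2)) :=
    (hQ.div_const 2).neg.exp
  have hI : StronglyMeasurable fun ap : ℍ × (ℝ × ℝ) => ∫ y : GnoFibre L, Real.exp (-(fibQ (if ap.1 = 0 then (1 : ℍ) else ap.1) ε ap.2 y / 2)) :=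
    hG.stronglyMeasurable.integral_prod_right'
  have hρ : Measurable fun ap : ℍ × (ℝ × ℝ) => gnoDensity (gnoBase ap.2.1 ap.2.2 : GnoCoord L) :=
    (gnoDensity_gnoBase_pos_continuous (L := L)).2.measurable.comp measurable_snd
  unfold mbDensity
  exact (hρ.mul measurable_const).mul hI.measurable

/-- ★★★ **STUB S3-ON-BULK: THE MORSE–BOTT DENSITY IS INTEGRABLE OVER (BULK HUBS) × ℝ²** — for good signs `ε` and every cut `0 < τ ≤ 1`,
`IntegrableOn (fun ap => 𝔪(ap.1, ε, ap.2)) (HubBulk τ ×ˢ univ) (coneMeasure ⊗ vol)` (majorant ✓`exists_mbDensity_le_weight_of_hubBulk` × probability cone measure;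
measurability ✓`measurable_mbDensity_hubFix`, the repair being invisible on `HubBulk τ ⊆ {a ≠ 0}`). [folklore] -/
theorem integrableOn_mbDensity_hubBulk {ε : GnoSign L} (hε : GoodSign ε) {τ : ℝ} (hτ : 0 < τ) (hτ1 : τ ≤ 1) :
    IntegrableOn (fun ap : ℍ × (ℝ × ℝ) => mbDensity (L := L) ap.1 ε ap.2) (HubBulk τ ×ˢ (univ : Set (ℝ × ℝ))) (coneMeasure.prod volume) := by
  classical
  haveI := isProbabilityMeasure_coneMeasure
  obtain ⟨C, hC0, hC⟩ := exists_mbDensity_le_weight_of_hubBulk (L := L) hε hτ hτ1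
  obtain ⟨hw0pos, hw0m, hw0i⟩ := rescaledWeight_facts
  have hS : MeasurableSet (HubBulk τ ×ˢ (univ : Set (ℝ × ℝ))) := (measurableSet_hubBulk τ).prod MeasurableSet.univ
  -- the majorant is integrable on the product (cone is a probability measure)
  have hg1 : Integrable (fun z : ℍ × (ℝ × ℝ) => (1 : ℝ) * ((1 + z.2.1 ^ 2)⁻¹ * (1 + z.2.2 ^ 2)⁻¹)) (coneMeasure.prod volume) :=
    (integrable_const (1 : ℝ)).mul_prod hw0i
  have hg : Integrable (fun z : ℍ × (ℝ × ℝ) => C * ((1 + z.2.1 ^ 2)⁻¹ * (1 + z.2.2 ^ 2)⁻¹)) (coneMeasure.prod volume) :=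
    (hg1.const_mul C).congr (Filter.Eventually.of_forall fun z => by ring)
  -- the repaired density is integrable on the bulk set
  have hfix : IntegrableOn (fun ap : ℍ × (ℝ × ℝ) => mbDensity (L := L) (if ap.1 = 0 then (1 : ℍ) else ap.1) ε ap.2) (HubBulk τ ×ˢ (univ : Set (ℝ × ℝ)))
      (coneMeasure.prod volume) := by
    refine Integrable.mono' hg.integrableOn (measurable_mbDensity_hubFix ε).aestronglyMeasurable ?_
    filter_upwards [ae_restrict_mem hS] with z hz
    obtain ⟨hzB, -⟩ := hz
    have hne : z.1 ≠ 0 := hzB.1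
    rw [if_neg hne, Real.norm_eq_abs, abs_of_nonneg (mbDensity_nonneg _ _ _)]
    exact hC z.1 hzB z.2
  -- and agrees with the density there
  refine (integrableOn_congr_fun (fun z hz => ?_) hS).1 hfix
  have hne : z.1 ≠ 0 := hz.1.1
  show mbDensity (if z.1 = 0 then (1 : ℍ) else z.1) ε z.2 = mbDensity z.1 ε z.2
  rw [if_neg hne]

/-- ★ Fubini corollary for g47's (Ra): `a ↦ ∫_{ℝ²} 𝔪(a,ε,p) dp` is integrable on `HubBulk τ` against the cone measure. [folklore] -/
theorem integrableOn_integral_mbDensity_hubBulk {ε : GnoSign L} (hε : GoodSign ε) {τ : ℝ} (hτ : 0 < τ) (hτ1 : τ ≤ 1) :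
    IntegrableOn (fun a : ℍ => ∫ p : ℝ × ℝ, mbDensity (L := L) a ε p) (HubBulk τ) coneMeasure := by
  haveI := isProbabilityMeasure_coneMeasure
  have h := integrableOn_mbDensity_hubBulk (L := L) hε hτ hτ1
  rw [IntegrableOn, ← Measure.restrict_prod_eq_prod_univ] at h
  exact h.integral_prod_left

end Summit.QuantumFields.YangMills.Theorems.SwapVirialDeficit.SectorLaplace

end
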